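import Summits.ResolutionOfSingularities.ResolutionOfSingularities.Theorems.HilbertSamuelEliminationSigmaMaxModificationsCorridor3WLadderMovingCells
import HarnessLib

/-!
# [OURS · L1 W4.2] `…Corridor3WLadderMovingPsi` — `ψ`-STABILITY along canonical near chains from a maximal origin:
# the POOL OBJECT `PsiStableNearStepM` of RULINGS v3.10-2 (β), its chain form `PsiStableAlongReachesM`, the consumer form
# `EdimStableAlongReachesM`, and the PROVED reductions (crux `SigmaMaxModifications` stmt-ResolutionOfSingularities-18506,
# conjunct `SigmaMaxModificationsCorridor3` stmt-…-19249; line `w_ladder` v6; cells of `…Corridor3WLadderMovingCells`)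

PROVENANCE. Every declaration below is res-type-053's (typer of record of the `…Corridor3WLadderMoving*` modules), typed and
farm-checked as the scratch `HOME/D/res-type-053/PsiStableSig.lean` sha16 `c93c81427665819b` (STATUS TYPED-SIGNATURE
2026-08-27T06:46:45Z), reproduced here BYTE-IDENTICAL (declarations, names, namespace
`…Theorems.SigmaMaxModificationsCorridor3.Moving`); landed for res-type-053 by the pool prover res-type-071 under res-L1-w42-plan-1
RULINGS v3.10-2 (β) «053: LAND the 3 defs + 3 proved reductions … so the pool prover proves `PsiStableNearStepM` BY NAME», so that
the proof file `…Corridor3PsiStable.lean` (res-type-071, `theorem psiStableNearStepM : PsiStableNearStepM p N`) can import the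
definition. Helper file `--supports stmt-ResolutionOfSingularities-19249`; no named facts, no `sorry`.

WHAT IS TYPED (053, verbatim): `PsiStableNearStepM p N` — «`ψ` (CJS Def. 2.28 (2), tree `Scheme.hsPsi`) does not change along ONE
canonical near step `s → s'` from a stage `s` reached from a maximal origin» (functional admissible oracle); `PsiStableAlongReachesM`
— the same along `Reaches`; `EdimStableAlongReachesM` — what the rows consume: the embedding dimension `Moving.edim` is constant along
canonical near chains from a maximal origin. PROVED: `mem_hsStratum_of_reaches` (marked points stay in `X_n(ν)`),
`psiStableAlongReachesM_of_nearStep` (induction on `Reaches`), `edimStableAlongReachesM_of_psiStable` (`ψ`-stable ⇒ `φ^N`-stable ⇒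
with `H^N = ν` constant, `edim_eq_of_hsFun_eq_of_hsPhi_eq` ⇒ `edim` constant). Consumers: the `QEdim4` / E5 cells (T6).

OURS (cell res-hironaka, slot W4.2, crux chain w42); NOT statements of the manuscript [Hironaka2017] nor of [CossartJannsenSaito2020];
AI-drafted, weaker than expert review. References: CJS LNM 2270 Def. 2.28 (2) (`ψ`, `φ`), Rem. 6.29 (1) [CossartJannsenSaito2020].
-/


noncomputable section

set_option linter.dupNamespace false

open CategoryTheory AlgebraicGeometry TopologicalSpace IsLocalRing
open Summit.ResolutionOfSingularities.ResolutionOfSingularities.Theorems.CampaignW42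
open Literature.AlgebraicGeometry.Resolution Literature.RingTheory.HilbertSamuel

namespace Summit.ResolutionOfSingularities.ResolutionOfSingularities.Theorems.SigmaMaxModificationsCorridor3.Moving

universe u

/-- [OURS · L1 W4.2] candidate pool object (ψ-stability, one step). -/
def PsiStableNearStepM (p N : ℕ) : Prop :=
  ∀ (R : ∀ S : Scheme.{u}, CentreSeq S → Prop), OracleFunctional R → OracleAdmissible R →
  ∀ (ν : ℕ → ℕ) (X : Scheme.{u}) [IsLocallyNoetherian X] (x : X), IsMaximalOrigin p N ν X x →
    ∀ s s' : MarkedStage.{u}, Reaches R N ν (MarkedStage.init X x) s → CanonicalNearStep R N ν s s' →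
      Scheme.hsPsi s'.W s'.pt = Scheme.hsPsi s.W s.pt

/-- [OURS · L1 W4.2] candidate pool object (ψ-stability along `Reaches`). -/
def PsiStableAlongReachesM (p N : ℕ) : Prop :=
  ∀ (R : ∀ S : Scheme.{u}, CentreSeq S → Prop), OracleFunctional R → OracleAdmissible R →
  ∀ (ν : ℕ → ℕ) (X : Scheme.{u}) [IsLocallyNoetherian X] (x : X), IsMaximalOrigin p N ν X x →
    ∀ s : MarkedStage.{u}, Reaches R N ν (MarkedStage.init X x) s →
      Scheme.hsPsi s.W s.pt = Scheme.hsPsi X x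

/-- [OURS · L1 W4.2] what the rows consume: `edim` is constant along canonical near chains from a maximal origin. -/
def EdimStableAlongReachesM (p N : ℕ) : Prop :=
  ∀ (R : ∀ S : Scheme.{u}, CentreSeq S → Prop), OracleFunctional R → OracleAdmissible R →
  ∀ (ν : ℕ → ℕ) (X : Scheme.{u}) [IsLocallyNoetherian X] (x : X), IsMaximalOrigin p N ν X x →
    ∀ s : MarkedStage.{u}, Reaches R N ν (MarkedStage.init X x) s →
      edim s = edim (MarkedStage.init X x)

/-- Along `Reaches` the marked point stays in the `ν`-stratum. -/
theorem mem_hsStratum_of_reaches {R : ∀ S : Scheme.{u}, CentreSeq S → Prop} {N : ℕ} {ν : ℕ → ℕ}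
    {X : Scheme.{u}} [IsLocallyNoetherian X] {x : X} (hx : x ∈ Scheme.hsStratum X N ν)
    {s : MarkedStage.{u}} (hs : Reaches R N ν (MarkedStage.init X x) s) :
    s.pt ∈ @Scheme.hsStratum s.W N ν := by
  induction hs with
  | refl => exact hx
  | tail _ hstep _ =>
    obtain ⟨C, P', h, x', -, -, -, hx', rfl⟩ := hstep
    exact hx'

/-- ψ-stability one step at a time gives ψ-stability along `Reaches`. -/
theorem psiStableAlongReachesM_of_nearStep (p N : ℕ) (h : PsiStableNearStepM.{u} p N) :
    PsiStableAlongReachesM.{u} p N := by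
  intro R hRf hRa ν X _ x hx s hs
  induction hs with
  | refl => rfl
  | tail hst hstep ih => rw [h R hRf hRa ν X x hx _ _ hst hstep, ih]

/-- ψ-stability gives `edim`-stability (with `edim_eq_of_hsFun_eq_of_hsPhi_eq`: near points have equal `H^N`). -/
theorem edimStableAlongReachesM_of_psiStable (p N : ℕ) (h : PsiStableAlongReachesM.{u} p N) :
    EdimStableAlongReachesM.{u} p N := by
  intro R hRf hRa ν X _ x hx s hs
  have hψ := h R hRf hRa ν X x hx s hs
  have hH : @Scheme.hsFun s.W N s.pt = Scheme.hsFun X N x := by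
    have h1 := mem_hsStratum_of_reaches (R := R) hx.mem_stratum hs
    have h2 := hx.mem_stratum
    rw [Scheme.mem_hsStratum_iff] at h1 h2
    rw [h1, h2]
  refine edim_eq_of_hsFun_eq_of_hsPhi_eq s (MarkedStage.init X x) hH ?_
  show N - Scheme.hsPsi s.W s.pt = N - Scheme.hsPsi X x
  rw [hψ]

end Summit.ResolutionOfSingularities.ResolutionOfSingularities.Theorems.SigmaMaxModificationsCorridor3.Moving

end
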